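import Literature.NumberTheory.DiophantineGeometry.GeneralizedFermatTwoPowerCoefficientFreyProofs
import Literature.NumberTheory.DiophantineGeometry.MinimalDiscriminantFactorizationProofs
import Literature.NumberTheory.DiophantineGeometry.MinimalDiscriminantProofs
import Literature.NumberTheory.EllipticCurves.PastenValuationProduct
import HarnessLib

/-!
# Ribet 1997, Theorem 3 for `α = 4` from Mestre–Oesterlé's Théorème 1 (proofs)

Topic `Literature/NumberTheory/DiophantineGeometry`; fifth sibling *proofs* file (theorems only:
no definition, no named fact, no `sorry`) of `GeneralizedFermatTwoPowerCoefficient` (named fact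
`ribet1997_twoPowerFermat`: K. Ribet, *On the equation `aᵖ + 2^α bᵖ + cᵖ = 0`*, Acta Arith. 79
(1997), Thm. 3, first sentence, `2 ≤ α < p`, `p ≥ 5`).

The four earlier siblings reduce Theorem 3 along Serre's road to the named facts
`khare_wintenberger`, `mazurKenku_exists_cyclic_isogeny`,
`artinConductorExponent_tate_eq_conductorExponent_of_isElliptic` and two printed local statements
(Serre 1987, §2.9 Prop. 5 and (4.1.12)).  This file records a **second, independent road for the
value `α = 4`**, closed modulo the single catalogued named fact
`EllipticCurves.mestreOesterle1989_thm_1` (J.-F. Mestre, J. Oesterlé, *Courbes de Weil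
semi-stables de discriminant une puissance `m`-ième*, J. reine angew. Math. 400 (1989), Thm. 1:
*a semistable (Weil) curve over `ℚ` whose minimal discriminant is an `m`-th power has `m ≤ 5`*).

Why `α = 4` is special (Ribet 1997, §2, p. 11): for `B = 2^α b^p` the exponent `t` of `2` in
`N_E = 2^t rad′(ABC)` is `0` exactly when `ord₂ (B) = 4`, i.e. the Frey curve
`E : y² = x (x − a^p)(x + 16 b^p)` (`a ≡ −1 (mod 4)`) is semistable with **good reduction at `2`**
(`b` odd) or multiplicative reduction at `2` with `p ∣ ord₂ Δ_E` (`b` even); in Serre's language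
`N(ρ̄) = 1`, and Ribet's argument ends with "`S₂(SL₂(ℤ)) = 0`" — which is precisely the case of
Ribet's theorem packaged by Mestre–Oesterlé's Théorème 1 (their proof, p. 177: modularity, Mazur,
Ribet's level-lowering to level `1`).  Concretely, by the tree's
`Ribet1997.ordMinimalDiscriminant_two_of_sixteen_dvd` and `ordMinimalDiscriminant_freyCurve_of_ne_two`
the minimal discriminant of `E` is `|Δ_E| = |abc|^{2p}` on the nose when `α = 4`
(`minimalDiscriminantNorm_freyCurve_sixteen`), a `2p`-th power with `|abc| ≥ 2`, so Théorème 1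
gives `2p ≤ 5`, absurd.  For `α ≠ 4` the `2`-part of `Δ_E` is `2^{2(α−4)+2p ord₂ b}` and `|Δ_E|`
is not a perfect `m`-th power with `m ≥ 6` in general, so this road covers `α = 4` only
(equivalently: `ρ̄_{E,p}` is ramified at `2`, level `2`, `8` or `32`).

## Main statements

* `minimalDiscriminantNorm_freyCurve_sixteen` — `|Δ_min (E)| = |abc|^{2p}` for the Frey curve of a
  normalised solution of `a^p + 16 b^p + c^p = 0`.
* `ribet1997_twoPowerFermat_four_of_mestreOesterle` — **Ribet's Theorem 3 for `α = 4`**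
  (`p ≥ 5`, pairwise coprime nonzero solutions) from `mestreOesterle1989_thm_1`.

## References

* [Ribet1997] K. A. Ribet, Acta Arith. 79 (1997), 7–16: Thm. 3, §2 (p. 11: `t = 0` for
  `ord₂ (B) = 4`), §3.
* [MestreOesterle1989] J.-F. Mestre, J. Oesterlé, J. reine angew. Math. 400 (1989), 173–184:
  Théorème 1 (p. 176) and its proof, part 1) (p. 177).
* [Serre1987] J.-P. Serre, Duke Math. J. 54 (1987), §4.1 (4.1.6), (4.1.12)–(4.1.13).
-/

noncomputable section

open UniqueFactorizationMonoid IsDedekindDomain WeierstrassCurve Rat.HeightOneSpectrum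
open Literature.NumberTheory.EllipticCurves

namespace Literature.NumberTheory.DiophantineGeometry

namespace Ribet1997

variable {p : ℕ} {a b c : ℤ}

/-- `v_q (|x|) = ord_q (x)` for a prime `q`: the exponent of `q` in the factorisation of `|x|` is
the integer `q`-adic valuation of `x`. [folklore] -/
theorem factorization_natAbs {q : ℕ} (hq : q.Prime) (x : ℤ) :
    x.natAbs.factorization q = padicValInt q x := by
  rw [Nat.factorization_def _ hq, padicValInt]

/-- **`|Δ_min (E)| = |abc|^{2p}` for `α = 4`.**  For odd `p` and a normalised solution
(`abc ≠ 0`, `a, b` and `a, c` coprime, `a ≡ −1 (mod 4)`) of `a^p + 2^4 b^p + c^p = 0`, the Frey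
curve `E : y² = x (x − a^p)(x + 16 b^p)` has minimal discriminant `|abc|^{2p}`: at `2`,
`ord₂ Δ_E = 2·4 + 2p ord₂ b − 8 = 2p ord₂ b` (`Ribet1997.ordMinimalDiscriminant_two_of_sixteen_dvd`,
Serre (4.1.6) `Δ = 2⁻⁸ A²B²C²`); at an odd `l`, `ord_l Δ_E = 2 ord_l (ABC) = 2p ord_l (abc)`
(`ordMinimalDiscriminant_freyCurve_of_ne_two`); and `|Δ_min| = ∏_l l^{ord_l Δ_E}`
(`factorization_minimalDiscriminantNorm_holds`). [cite: Ribet1997, §2, p. 11]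
[cite: Serre1987, §4.1 (4.1.6) and (4.1.13)] -/
theorem minimalDiscriminantNorm_freyCurve_sixteen (hp : Odd p) (h0 : a * b * c ≠ 0)
    (hab : IsCoprime a b) (hac : IsCoprime a c) (ha : a ≡ -1 [ZMOD 4])
    (heq : a ^ p + 2 ^ 4 * b ^ p + c ^ p = 0) :
    (freyCurve (a ^ p) (2 ^ 4 * b ^ p)).minimalDiscriminantNorm ℤ = (a * b * c).natAbs ^ (2 * p) := by
  obtain ⟨hcop, hne, hA, -, hsum⟩ := monomials hp (by norm_num : 2 ≤ 4) h0 hab hac ha heq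
  have hp0 : p ≠ 0 := hp.pos.ne'
  obtain ⟨hao, hco⟩ := odd_of_eq hp0 (by norm_num : 4 ≠ 0) hac heq
  have h16 : (16 : ℤ) ∣ 2 ^ 4 * b ^ p := dvd_mul_right _ _
  set W : WeierstrassCurve ℚ := freyCurve (a ^ p) (2 ^ 4 * b ^ p) with hW
  haveI : W.IsElliptic := isElliptic_freyCurve hne
  have hx0 : (a * b * c).natAbs ≠ 0 := Int.natAbs_ne_zero.mpr h0
  simp only [ne_eq, mul_eq_zero, not_or] at h0
  obtain ⟨⟨ha0, hb0⟩, hc0⟩ := h0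
  refine Nat.eq_of_factorization_eq (minimalDiscriminantNorm_pos_holds W).ne' (pow_ne_zero _ hx0)
    fun q ↦ ?_
  by_cases hq : q.Prime
  swap
  · rw [Nat.factorization_eq_zero_of_not_prime _ hq, Nat.factorization_eq_zero_of_not_prime _ hq]
  rw [Nat.factorization_pow, Finsupp.smul_apply, smul_eq_mul, factorization_natAbs hq]
  haveI : Fact q.Prime := ⟨hq⟩
  set v : HeightOneSpectrum ℤ := (primesEquiv (R := ℤ)).symm ⟨q, hq⟩ with hv_def
  have hv : natGenerator v = q := Rat.natGenerator_primesEquiv_symm ⟨q, hq⟩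
  haveI : Fact (natGenerator v).Prime := ⟨prime_natGenerator v⟩
  rw [← hv, WeierstrassCurve.factorization_minimalDiscriminantNorm_holds W v]
  have habc : padicValInt (natGenerator v) (a * b * c) =
      padicValInt (natGenerator v) a + padicValInt (natGenerator v) b +
        padicValInt (natGenerator v) c := by
    rw [padicValInt.mul (mul_ne_zero ha0 hb0) hc0, padicValInt.mul ha0 hb0]
  by_cases hq2 : q = 2
  · -- the prime `2`: `ord₂ Δ_E + 8 = 2·4 + 2p ord₂ b`, and `a`, `c` are odd
    subst hq2
    have key := ordMinimalDiscriminant_two_of_sixteen_dvd hp (by norm_num : 2 ≤ 4)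
      (mul_ne_zero (mul_ne_zero ha0 hb0) hc0) hab hac ha heq h16 v hv
    rw [← hW] at key
    rw [hv] at habc ⊢
    rw [habc, padicValInt.eq_zero_of_not_dvd (Int.two_dvd_ne_zero.mpr (Int.odd_iff.mp hao)),
      padicValInt.eq_zero_of_not_dvd (Int.two_dvd_ne_zero.mpr (Int.odd_iff.mp hco)), zero_add,
      add_zero]
    omega
  · -- an odd prime: `ord_l Δ_E = 2 ord_l (ABC)` and `ord_l (16) = 0`
    rw [ordMinimalDiscriminant_freyCurve_of_ne_two hcop hne v (by rw [hv]; exact hq2), hsum,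
      padicValInt.mul (mul_ne_zero (pow_ne_zero _ ha0)
        (mul_ne_zero (pow_ne_zero _ two_ne_zero) (pow_ne_zero _ hb0)))
        (neg_ne_zero.mpr (pow_ne_zero _ hc0)),
      padicValInt.mul (pow_ne_zero _ ha0) (mul_ne_zero (pow_ne_zero _ two_ne_zero) (pow_ne_zero _ hb0)),
      padicValInt.mul (pow_ne_zero _ two_ne_zero) (pow_ne_zero _ hb0), padicValInt_neg,
      padicValInt_pow, padicValInt_pow, padicValInt_pow, padicValInt_pow, habc]
    have h2 : padicValInt (natGenerator v) 2 = 0 := by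
      refine padicValInt.eq_zero_of_not_dvd fun h ↦ hq2 ?_
      rw [← hv]
      have h' : (natGenerator v : ℤ) ∣ 2 := h
      have := Int.le_of_dvd two_pos h'
      have h1 := (prime_natGenerator v).two_le
      omega
    rw [h2]
    ring

/-- **`|abc| ≥ 2` for a solution of `a^p + 16 b^p + c^p = 0` with `abc ≠ 0`**: if
`|a| = |b| = |c| = 1` then `|a^p + c^p| ≤ 2 < 16 = |16 b^p|`. [folklore] -/
theorem two_le_natAbs_of_eq (h0 : a * b * c ≠ 0) (heq : a ^ p + 2 ^ 4 * b ^ p + c ^ p = 0) :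
    2 ≤ (a * b * c).natAbs := by
  have h1 : (a * b * c).natAbs ≠ 0 := Int.natAbs_ne_zero.mpr h0
  by_contra hlt
  have hone : (a * b * c).natAbs = 1 := by omega
  rw [Int.natAbs_mul, Int.natAbs_mul] at hone
  have hab1 : a.natAbs * b.natAbs = 1 := Nat.eq_one_of_mul_eq_one_right hone
  have hc1 : c.natAbs = 1 := Nat.eq_one_of_mul_eq_one_left hone
  have ha1 : a.natAbs = 1 := Nat.eq_one_of_mul_eq_one_right hab1
  have hb1 : b.natAbs = 1 := Nat.eq_one_of_mul_eq_one_left hab1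
  have hmid : (2 ^ 4 * b ^ p).natAbs = 16 := by
    rw [Int.natAbs_mul, Int.natAbs_pow, Int.natAbs_pow, hb1, one_pow, mul_one]
    norm_num
  have hsum : 2 ^ 4 * b ^ p = -(a ^ p + c ^ p) := by linear_combination heq
  have hle : (2 ^ 4 * b ^ p).natAbs ≤ (a ^ p).natAbs + (c ^ p).natAbs := by
    rw [hsum, Int.natAbs_neg]
    exact Int.natAbs_add_le _ _
  rw [hmid, Int.natAbs_pow, Int.natAbs_pow, ha1, hc1, one_pow] at hle
  omega

end Ribet1997

/-- **Ribet 1997, Theorem 3 for `α = 4`, from Mestre–Oesterlé's Théorème 1.**  Granted the named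
fact `EllipticCurves.mestreOesterle1989_thm_1` (a semistable elliptic curve over `ℚ` whose minimal
discriminant is an `m`-th power, `m ≥ 1`, of an integer `≥ 2` has `m ≤ 5`; Mestre–Oesterlé 1989,
Thm. 1, whose printed proof for prime `m ≥ 11` is exactly Ribet's argument at level `1`:
modularity, Mazur, level-lowering, `S₂(SL₂(ℤ)) = 0`), the equation `x^p + 16 y^p + z^p = 0`,
`p ≥ 5` prime, has no solution in pairwise coprime nonzero integers — the value `α = 4` of
`ribet1997_twoPowerFermat` (Ribet 1997, Thm. 3; §2, p. 11: `t = 0` when `ord₂ (B) = 4`).  Proof: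
normalise to `a ≡ −1 (mod 4)` (`Ribet1997.exists_normalized`); the Frey curve
`y² = x (x − a^p)(x + 16 b^p)` is semistable (`isSemistable_freyCurve_of_sixteen_dvd`) with
`|Δ_min| = |abc|^{2p}` (`Ribet1997.minimalDiscriminantNorm_freyCurve_sixteen`) and `|abc| ≥ 2`
(`Ribet1997.two_le_natAbs_of_eq`), so Théorème 1 gives `2p ≤ 5`.
[cite: Ribet1997, Thm. 3 and §2, p. 11] [cite: MestreOesterle1989, Théorème 1 (p. 176)] -/
theorem ribet1997_twoPowerFermat_four_of_mestreOesterle (hMO : mestreOesterle1989_thm_1) {p : ℕ}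
    (hp : p.Prime) (h5 : 5 ≤ p) {x y z : ℤ} (h0 : x * y * z ≠ 0) (hxy : IsCoprime x y)
    (hxz : IsCoprime x z) (hyz : IsCoprime y z) : x ^ p + 2 ^ 4 * y ^ p + z ^ p ≠ 0 := by
  intro heq
  have hodd : Odd p := hp.odd_of_ne_two (by omega)
  obtain ⟨a, b, c, h0', hab, hac, -, ha, heq'⟩ :=
    Ribet1997.exists_normalized hodd (by norm_num : 4 ≠ 0) h0 hxy hxz hyz heq
  obtain ⟨hcop, hne, hA, -, -⟩ := Ribet1997.monomials hodd (by norm_num : 2 ≤ 4) h0' hab hac ha heq'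
  have h16 : (16 : ℤ) ∣ 2 ^ 4 * b ^ p := dvd_mul_right _ _
  haveI : (freyCurve (a ^ p) (2 ^ 4 * b ^ p)).IsElliptic := isElliptic_freyCurve hne
  have hle : 2 * p ≤ 5 :=
    hMO (freyCurve (a ^ p) (2 ^ 4 * b ^ p)) (isSemistable_freyCurve_of_sixteen_dvd hcop hne hA h16)
      (2 * p) (a * b * c).natAbs (Ribet1997.two_le_natAbs_of_eq h0' heq')
      (Ribet1997.minimalDiscriminantNorm_freyCurve_sixteen hodd h0' hab hac ha heq')
  omega

/-- The value `α = 4` of the vendored fact, as an instance of its quantifier shape: granted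
`mestreOesterle1989_thm_1`, `ribet1997_twoPowerFermat` holds at `r = 4` (for every prime `p ≥ 5`;
the bound `r < p` is automatic). [cite: Ribet1997, Thm. 3] [cite: MestreOesterle1989, Théorème 1 (p. 176)] -/
theorem ribet1997_twoPowerFermat_of_mestreOesterle_of_eq_four (hMO : mestreOesterle1989_thm_1) :
    ∀ p : ℕ, p.Prime → 5 ≤ p → ∀ r : ℕ, r = 4 → ∀ x y z : ℤ, x * y * z ≠ 0 →
      IsCoprime x y → IsCoprime x z → IsCoprime y z → x ^ p + 2 ^ r * y ^ p + z ^ p ≠ 0 := by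
  rintro p hp h5 r rfl x y z h0 hxy hxz hyz
  exact ribet1997_twoPowerFermat_four_of_mestreOesterle hMO hp h5 h0 hxy hxz hyz

end Literature.NumberTheory.DiophantineGeometry
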